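import Summits.MatrixMultiplication.MatrixMultiplication.Theorems.GraphEquationsJetCount
import Summits.MatrixMultiplication.MatrixMultiplication.Theorems.GraphEquationsGeneratorSurgery
import Summits.MatrixMultiplication.MatrixMultiplication.Theses.GraphEquations

/-!
# GraphEquations — exponent descent (THEOREM ED) and `hM ⟸ ExponentBound`

Decomp-mm node «GraphEquations» (lens 5), attacked crux `MultiplicityReduction` (route
GraphEquations, item stmt-MatrixMultiplication-27806), registered line
`Cruxes/MultiplicityReduction/Lines/birth.lean` («exponent ladder»:
`stub_exponentBound → stub_exponentDescent → expOneReduced`).  This file proves the MIDDLE STUB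
`stub_exponentDescent` by statement (`theorem exponentDescent`, S6(a)) and records the resulting
one-stub reduction `multiplicityReduction_of_exponentBound` (S6(b)): the crux follows from the
exponent bound ALONE.

THEOREM ED (paper: lens-5 g94, critic-checked g36; Lean text: g95–g101 typing packets and drafts,
identifiers audited by the census; first elaboration, the three library lemmas `exists_dual_family`,
`exists_isHomogeneous_lift`, the dimension count `hdim` of `jet_count`, and S6(b): g122).
For a correct system `E` of cost `L` with exponent witness `(g, M)` (`g · 𝕀(W_n)^M ⊆ (tests)`,
`g ∉ 𝕀(W_n)`) and a graph point `x` with `g(x) ≠ 0`, the corank `s` of the `C`-Jacobian at `x`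
satisfies `s (s + M − 1) ≤ M (M − 1) · L` (jet count in the fibre `{A = A(x), B = B(x)}`), and
adjoining `s` plain generators `f_q` (`2n` fan-in-two gates each) gives a correct system reduced at
`x`, whence (Cramer) an exponent-ONE witness `g · Δ^{M−1}`; the cost stays `O(n^β)`.

CONTENT (parts 1–3 are the imported modules `…FibreJet` (S1, S2 steps 1–4), `…JetCount`
(S2, THEOREM ED (a)), `…GeneratorSurgery` (S3, THEOREM ED (b) surgery half)):
* S4  `EqSystem.exponentOne_of_reducedAt`                 — THEOREM ED (b), Cramer;
* S5  `exponentDescent_red`                               — COR ED-1 at fixed exponent;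
* S6(a) `exponentDescent` = the statement of `stub_exponentDescent` verbatim;
* S6(b) `multiplicityReduction_of_exponentBound` : (statement of `stub_exponentBound`) →
        `Theses.GraphEquations.MultiplicityReduction` (by name; the route file is imported for it).
-/
set_option linter.dupNamespace false

namespace Summit.MatrixMultiplication.MatrixMultiplication.Theorems.GraphEquations

open MvPolynomial
-- `Basis` below is `Module.Basis` (tree precedent `open Matrix Module`,
-- GraphEquationsCorankUnmasking l.49).
open Module
open Literature.Computability.AlgebraicComplexity
open Literature.Computability.AlgebraicComplexity.ArithCircuit
open Literature.AlgebraicGeometry.Hironaka2017.EdgeAlgebra (isHomogeneous_aeval_linear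
  homogeneousComponent_aeval_linear)
open Literature.AlgebraicGeometry.Resolution (homogeneousComponent_eq_zero_of_mem_pow_idealOfVars
  mem_pow_idealOfVars_of_isHomogeneous sub_sum_homogeneousComponent_mem_pow_idealOfVars)

variable {n : ℕ}

namespace EqSystem

/-! ## S4: Cramer — reduced at a point with `g(x) ≠ 0` forces exponent one (THEOREM ED (b)) -/

/-- **S4.**  `E` correct and reduced at `x ∈ W_n`, `g ∉ 𝕀(W_n)`, `M ≥ 1`, `g · 𝕀^M ⊆ T_E`
⇒ `g′ · 𝕀 ⊆ T_E` for `g′ = g · Δ^{M−1} ∉ 𝕀`, where `Δ = det (P · J_poly)` for a numeric left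
inverse `P` of `J_C(x)` (c1′), so `Δ(x) = 1`; `adj · (P J_poly) = Δ · 1` and Taylor mod `I²` (L3)
give `Δ · I ⊆ T ⊔ I²` (c3–c4), induction gives `Δ^k · I ⊆ T ⊔ I^{k+1}` (c5). -/
theorem exponentOne_of_reducedAt {E : EqSystem n} (hE : E.Correct) {x : GraphVars n → ℂ}
    (hx : x ∈ mmGraph n) (hred : E.ReducedAt x) {g : MvPolynomial (GraphVars n) ℂ}
    (hg : g ∉ MvPolynomial.vanishingIdeal ℂ (mmGraph n)) {M : ℕ} (hM : 1 ≤ M)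
    (hle : Ideal.span {g} * MvPolynomial.vanishingIdeal ℂ (mmGraph n) ^ M ≤
      Ideal.span {p | ∃ j ∈ E.tests, p = E.testPoly j}) :
    ∃ g' : MvPolynomial (GraphVars n) ℂ, g' ∉ MvPolynomial.vanishingIdeal ℂ (mmGraph n) ∧
      Ideal.span {g'} * MvPolynomial.vanishingIdeal ℂ (mmGraph n) ≤
        Ideal.span {p | ∃ j ∈ E.tests, p = E.testPoly j} := by
  classical
  -- notation
  set T : Ideal (MvPolynomial (GraphVars n) ℂ) := Ideal.span {p | ∃ j ∈ E.tests, p = E.testPoly j}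
    with hT
  set I : Ideal (MvPolynomial (GraphVars n) ℂ) := graphIdeal n with hI
  have h𝕀 : MvPolynomial.vanishingIdeal ℂ (mmGraph n) = I := vanishingIdeal_eq_graphIdeal n
  -- the polynomial `C`-Jacobian and its evaluation (GraphEquationsSystems l.119)
  let Jp : Matrix (Fin E.tests.length) (Fin n × Fin n) (MvPolynomial (GraphVars n) ℂ) :=
    Matrix.of fun s q => MvPolynomial.pderiv (Sum.inr q) (E.testPoly (E.tests.get s))
  have hJp : Jp.map (MvPolynomial.eval x) = E.jacobianC x := by
    ext s q; rfl
  -- c1′: numeric left inverse; c2: `S = P J_poly`, `Δ = det S`, `Q = adj S · P`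
  obtain ⟨P, hP⟩ := exists_leftInverse_of_reducedAt hred
  -- the constant matrix `P` with polynomial entries (typed FIRST, so that the matrix products
  -- below are elaborated with the `Matrix` instances)
  set PC : Matrix (Fin n × Fin n) (Fin E.tests.length) (MvPolynomial (GraphVars n) ℂ) :=
    P.map MvPolynomial.C with hPCdef
  set S : Matrix (Fin n × Fin n) (Fin n × Fin n) (MvPolynomial (GraphVars n) ℂ) := PC * Jp
    with hS
  set Δ : MvPolynomial (GraphVars n) ℂ := S.det with hΔdef
  set Q : Matrix (Fin n × Fin n) (Fin E.tests.length) (MvPolynomial (GraphVars n) ℂ) :=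
    S.adjugate * PC with hQ
  have hQJ : Q * Jp = Δ • (1 : Matrix (Fin n × Fin n) (Fin n × Fin n) _) := by
    -- `adjugate_mul : adjugate A * A = A.det • 1`
    rw [hQ, hΔdef, Matrix.mul_assoc, ← hS, Matrix.adjugate_mul]
  have hΔx : MvPolynomial.eval x Δ = 1 := by
    rw [hΔdef, hS, RingHom.map_det, RingHom.mapMatrix_apply, Matrix.map_mul, hJp, hPCdef,
      Matrix.map_map]
    have hPC : (P.map (⇑(MvPolynomial.eval x) ∘ ⇑C)) = P := by
      ext i j; simp
    rw [hPC, hP, Matrix.det_one]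
  have hΔ : Δ ∉ I := not_mem_graphIdeal_of_eval_ne_zero hx (by rw [hΔx]; exact one_ne_zero)
  -- c3–c4: `Δ · I ⊆ T ⊔ I²`
  have hstep : Ideal.span {Δ} * I ≤ T ⊔ I ^ 2 := by
    rw [Ideal.span_singleton_mul_le_iff]
    intro z hz
    -- reduce to the generators `f_q` of `I = span (range f)` by span induction
    have hz' : z ∈ Submodule.span (MvPolynomial (GraphVars n) ℂ) (Set.range (generator n)) := hz
    refine Submodule.span_induction (p := fun z _ => Δ * z ∈ T ⊔ I ^ 2) ?_ ?_ ?_ ?_ hz'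
    · rintro _ ⟨q, rfl⟩
      -- Taylor mod `I²` for each test (L3): `t_s − Σ_p J_{sp} f_p ∈ I²`
      have ht : ∀ s : Fin E.tests.length,
          E.testPoly (E.tests.get s) - ∑ p, Jp s p * generator n p ∈ I ^ 2 := fun s =>
        taylor_mod_sq (hE.testPoly_mem_graphIdeal' (List.get_mem _ _))
      -- the identity `Δ f_q = Σ_s Q_{qs} t_s − Σ_s Q_{qs} (t_s − Σ_p J_{sp} f_p)`
      have hid : Δ * generator n q =
          (∑ s, Q q s * E.testPoly (E.tests.get s)) -
            ∑ s, Q q s * (E.testPoly (E.tests.get s) - ∑ p, Jp s p * generator n p) := by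
        -- S4 (c4): cancel the test terms,
        -- swap the two finite sums, recognise `(Q * Jp) q p` (`Matrix.mul_apply`) and use
        -- `hQJ : Q * Jp = Δ • 1` (`Matrix.smul_apply`, `Matrix.one_apply`, `Finset.sum_ite_eq`).
        rw [eq_comm]
        calc (∑ s, Q q s * E.testPoly (E.tests.get s)) -
              ∑ s, Q q s * (E.testPoly (E.tests.get s) - ∑ p, Jp s p * generator n p)
            = ∑ s, Q q s * ∑ p, Jp s p * generator n p := by
              simp only [mul_sub, Finset.sum_sub_distrib, sub_sub_cancel]
          _ = ∑ p, (∑ s, Q q s * Jp s p) * generator n p := by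
              simp only [Finset.mul_sum, Finset.sum_mul, mul_assoc]
              exact Finset.sum_comm
          _ = ∑ p, (Q * Jp) q p * generator n p := by
              simp only [Matrix.mul_apply]
          _ = Δ * generator n q := by
              simp only [hQJ, Matrix.smul_apply, Matrix.one_apply, smul_eq_mul, mul_ite, mul_one,
                mul_zero, ite_mul, zero_mul, Finset.sum_ite_eq, Finset.mem_univ, if_true]
      rw [hid]
      refine Ideal.sub_mem _ (Ideal.mem_sup_left ?_) (Ideal.mem_sup_right ?_)
      · exact Ideal.sum_mem _ fun s _ =>
          Ideal.mul_mem_left _ _ (Ideal.subset_span ⟨E.tests.get s, List.get_mem _ _, rfl⟩)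
      · exact Ideal.sum_mem _ fun s _ => Ideal.mul_mem_left _ _ (ht s)
    · simp
    · intro a b _ _ ha hb
      rw [mul_add]
      exact Ideal.add_mem _ ha hb
    · intro a b _ hb
      rw [smul_eq_mul, mul_left_comm]
      exact Ideal.mul_mem_left _ _ hb
  -- c5: induction `Δ^{k+1} · I ⊆ T ⊔ I^{k+2}`
  have hpow : ∀ k : ℕ, Ideal.span {Δ ^ (k + 1)} * I ≤ T ⊔ I ^ (k + 2) := by
    intro k
    induction k with
    | zero => simpa [pow_one] using hstep
    | succ k ih =>
      calc Ideal.span {Δ ^ (k + 1 + 1)} * I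
          = Ideal.span {Δ} * (Ideal.span {Δ ^ (k + 1)} * I) := by
            rw [← mul_assoc, Ideal.span_singleton_mul_span_singleton, ← pow_succ']
        _ ≤ Ideal.span {Δ} * (T ⊔ I ^ (k + 2)) := Ideal.mul_mono_right ih
        _ = Ideal.span {Δ} * T ⊔ Ideal.span {Δ} * I ^ (k + 2) := Ideal.mul_sup _ _ _
        _ ≤ T ⊔ (Ideal.span {Δ} * I) * I ^ (k + 1) :=
            sup_le_sup Ideal.mul_le_left (by rw [mul_assoc, ← pow_succ'])
        _ ≤ T ⊔ (T ⊔ I ^ 2) * I ^ (k + 1) := sup_le_sup_left (Ideal.mul_mono_left hstep) _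
        _ = T ⊔ (T * I ^ (k + 1) ⊔ I ^ 2 * I ^ (k + 1)) := by rw [Ideal.sup_mul]
        _ ≤ T ⊔ I ^ (k + 1 + 2) :=
            sup_le le_sup_left (sup_le (Ideal.mul_le_right.trans le_sup_left) (by
              rw [← pow_add, show 2 + (k + 1) = k + 1 + 2 by omega]
              exact le_sup_right))
  -- the witness `g′ = g Δ^{M−1}`
  obtain ⟨k, rfl⟩ : ∃ k, M = k + 1 := ⟨M - 1, by omega⟩
  refine ⟨g * Δ ^ k, ?_, ?_⟩
  · -- `I` prime (`graphIdeal_isPrime`, Surgery l.61): `g ∉ I`, `Δ ∉ I` ⇒ `g Δ^k ∉ I`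
    rw [h𝕀] at hg ⊢
    intro hmem
    rcases graphIdeal_isPrime.mem_or_mem hmem with h | h
    · exact hg h
    · exact hΔ (graphIdeal_isPrime.mem_of_pow_mem _ h)
  · rw [h𝕀] at hle ⊢
    cases k with
    | zero => simpa using hle
    | succ k =>
      calc Ideal.span {g * Δ ^ (k + 1)} * I
          = Ideal.span {g} * (Ideal.span {Δ ^ (k + 1)} * I) := by
            rw [← mul_assoc, Ideal.span_singleton_mul_span_singleton]
        _ ≤ Ideal.span {g} * (T ⊔ I ^ (k + 2)) := Ideal.mul_mono_right (hpow k)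
        _ = Ideal.span {g} * T ⊔ Ideal.span {g} * I ^ (k + 2) := Ideal.mul_sup _ _ _
        _ ≤ T ⊔ T := sup_le_sup Ideal.mul_le_left hle
        _ = T := sup_idem _

end EqSystem

/-! ## S5: COR ED-1 — bounded exponent descends to exponent one at the SAME exponent -/

/-- **S5 (COR ED-1).**  From an exponent-`M` family of cost `≤ c n^β` (`β ≥ 2`) to an exponent-one
family of cost `≤ (c + 2M√c) n^β`: at a graph point `x` with `g(x) ≠ 0`, adjoin the
`s ≤ M √cost` kernel coordinates (S2: `s² ≤ s(s+M−1) ≤ M(M−1)·cost`) at `2n` gates each (S3) and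
read off exponent one by Cramer (S4); `2 n M √(c n^β) = 2M√c · n^{1+β/2} ≤ 2M√c · n^β`. -/
theorem exponentDescent_red (M : ℕ) {β : ℝ} (hβ : 2 ≤ β)
    (h : ∃ c : ℝ, ∀ n : ℕ, 1 ≤ n → ∃ E : EqSystem n, E.Correct ∧
      (∃ g : MvPolynomial (GraphVars n) ℂ, g ∉ MvPolynomial.vanishingIdeal ℂ (mmGraph n) ∧
        Ideal.span {g} * MvPolynomial.vanishingIdeal ℂ (mmGraph n) ^ M ≤
          Ideal.span {p | ∃ j ∈ E.tests, p = E.testPoly j}) ∧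
      (E.cost : ℝ) ≤ c * (n : ℝ) ^ β) :
    ∃ c : ℝ, ∀ n : ℕ, 1 ≤ n → ∃ E : EqSystem n, E.Correct ∧
      (∃ g : MvPolynomial (GraphVars n) ℂ, g ∉ MvPolynomial.vanishingIdeal ℂ (mmGraph n) ∧
        Ideal.span {g} * MvPolynomial.vanishingIdeal ℂ (mmGraph n) ≤
          Ideal.span {p | ∃ j ∈ E.tests, p = E.testPoly j}) ∧
      (E.cost : ℝ) ≤ c * (n : ℝ) ^ β := by
  obtain ⟨c, hc⟩ := h
  -- `0 ≤ c` (instance `n = 1`)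
  have hc0 : 0 ≤ c := by
    obtain ⟨E, -, -, hcost⟩ := hc 1 le_rfl
    have h0 : (0 : ℝ) ≤ (E.cost : ℝ) := Nat.cast_nonneg _
    have : (E.cost : ℝ) ≤ c := by simpa [Real.one_rpow] using hcost
    linarith
  refine ⟨c + 2 * M * Real.sqrt c, fun n hn => ?_⟩
  obtain ⟨E, hE, ⟨g, hg, hle⟩, hcost⟩ := hc n hn
  have hroom : c * (n : ℝ) ^ β ≤ (c + 2 * M * Real.sqrt c) * (n : ℝ) ^ β :=
    mul_le_mul_of_nonneg_right (le_add_of_nonneg_right (by positivity))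
      (Real.rpow_nonneg (Nat.cast_nonneg _) _)
  -- a graph point off `g = 0` (pattern `exponentOneReduced`, ExponentOne l.138–145)
  have hg' := hg
  rw [MvPolynomial.mem_vanishingIdeal_iff] at hg'
  push Not at hg'
  obtain ⟨x, hx, hgx⟩ := hg'
  have hgx' : MvPolynomial.eval x g ≠ 0 := by
    simpa [MvPolynomial.coe_aeval_eq_eval] using hgx
  rcases Nat.lt_or_ge M 2 with hM | hM
  · interval_cases M
    · -- `M = 0`: `g ∈ span{g} · 𝕀^0 = span{g} ⊆ T_E ⊆ 𝕀(W_n)` contradicts `g ∉ 𝕀(W_n)`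
      exfalso
      apply hg
      have hT : Ideal.span {p | ∃ j ∈ E.tests, p = E.testPoly j} ≤
          MvPolynomial.vanishingIdeal ℂ (mmGraph n) := by
        refine Ideal.span_le.mpr ?_
        rintro _ ⟨j, hj, rfl⟩
        rw [SetLike.mem_coe, MvPolynomial.mem_vanishingIdeal_iff]
        intro y hy
        simpa [MvPolynomial.coe_aeval_eq_eval] using hE.eval_testPoly_eq_zero hy hj
      refine hT (hle ?_)
      -- `pow_zero`, `Ideal.one_eq_top`, `Ideal.mul_top` (or `mul_one`).
      simp [pow_zero, Ideal.one_eq_top, Ideal.mul_top]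
    · -- `M = 1`: nothing to do
      exact ⟨E, hE, ⟨g, hg, by rw [pow_one] at hle; exact hle⟩, hcost.trans hroom⟩
  · -- `M ≥ 2`: THEOREM ED
    obtain ⟨E', hE', hred, hcost', hspan⟩ := EqSystem.exists_adjoin_reducedAt hE hn hx
    obtain ⟨g', hg'I, hle''⟩ :=
      EqSystem.exponentOne_of_reducedAt hE' hx hred hg (by omega) (hle.trans hspan)
    refine ⟨E', hE', ⟨g', hg'I, hle''⟩, ?_⟩
    -- the corank bound `s ≤ M √cost` from S2
    have hjet := EqSystem.jetCount hE hx hgx' hM hle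
    set s := E.corank x with hs
    have hs0 : (0 : ℝ) ≤ s := Nat.cast_nonneg _
    have hsq : (s : ℝ) ^ 2 ≤ ((M : ℝ) * Real.sqrt (E.cost : ℝ)) ^ 2 := by
      have h1 : s * s ≤ M * M * E.cost :=
        calc s * s ≤ s * (s + M - 1) := Nat.mul_le_mul_left _ (by omega)
          _ ≤ M * (M - 1) * E.cost := hjet
          _ ≤ M * M * E.cost := Nat.mul_le_mul_right _ (Nat.mul_le_mul_left _ (Nat.sub_le _ _))
      rw [mul_pow, Real.sq_sqrt (Nat.cast_nonneg _)]
      have h1' : ((s * s : ℕ) : ℝ) ≤ ((M * M * E.cost : ℕ) : ℝ) := by exact_mod_cast h1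
      push_cast at h1'
      nlinarith [h1']
    have hsM : (s : ℝ) ≤ M * Real.sqrt (E.cost : ℝ) := by
      -- `Real.sqrt_le_sqrt` + `Real.sqrt_sq` (Analysis/Real/Sqrt.lean l.209 / l.181).
      have := Real.sqrt_le_sqrt hsq
      rwa [Real.sqrt_sq hs0, Real.sqrt_sq (by positivity)] at this
    -- real-analysis bookkeeping
    have hn1 : (1 : ℝ) ≤ n := by exact_mod_cast hn
    have hn0 : (0 : ℝ) < n := by positivity
    have hsqrtL : Real.sqrt (E.cost : ℝ) ≤ Real.sqrt c * (n : ℝ) ^ (β / 2) := by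
      calc Real.sqrt (E.cost : ℝ) ≤ Real.sqrt (c * (n : ℝ) ^ β) := Real.sqrt_le_sqrt hcost
        _ = Real.sqrt c * Real.sqrt ((n : ℝ) ^ β) := Real.sqrt_mul hc0 _
        _ = Real.sqrt c * (n : ℝ) ^ (β / 2) := by
            -- `Real.sqrt_eq_rpow` (Pow/Real.lean l.984), `Real.rpow_mul`.
            rw [Real.sqrt_eq_rpow ((n : ℝ) ^ β), ← Real.rpow_mul hn0.le]
            ring_nf
    have hpow : (n : ℝ) * (n : ℝ) ^ (β / 2) ≤ (n : ℝ) ^ β := by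
      calc (n : ℝ) * (n : ℝ) ^ (β / 2) = (n : ℝ) ^ (1 + β / 2) := by
            rw [Real.rpow_add hn0, Real.rpow_one]
        _ ≤ (n : ℝ) ^ β := Real.rpow_le_rpow_of_exponent_le hn1 (by linarith)
    have hcostR : (E'.cost : ℝ) ≤ E.cost + 2 * n * s := by exact_mod_cast hcost'
    calc (E'.cost : ℝ) ≤ E.cost + 2 * n * s := hcostR
      _ ≤ c * (n : ℝ) ^ β + 2 * n * (M * (Real.sqrt c * (n : ℝ) ^ (β / 2))) := by
          gcongr
          exact hsM.trans (mul_le_mul_of_nonneg_left hsqrtL (Nat.cast_nonneg _))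
      _ = c * (n : ℝ) ^ β + 2 * M * Real.sqrt c * ((n : ℝ) * (n : ℝ) ^ (β / 2)) := by ring
      _ ≤ c * (n : ℝ) ^ β + 2 * M * Real.sqrt c * (n : ℝ) ^ β := by gcongr
      _ = (c + 2 * M * Real.sqrt c) * (n : ℝ) ^ β := by ring

/-! ## S6(a): the registered stub `stub_exponentDescent`, BY STATEMENT -/

/-- **Exponent descent** — the statement of `stub_exponentDescent`
(Cruxes/MultiplicityReduction/Lines/birth.lean l.40–51) verbatim: a bounded-exponent family of cost
`O(n^β)`, `β ≥ 2`, yields an exponent-one family of cost `O(n^{β′})` for every `β′ > β`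
(indeed at `β′ = β`, S5; then monotonicity in the exponent, pattern `EqAdmissible.mono`,
GraphEquationsSystems l.191–201). -/
theorem exponentDescent : ∀ (M : ℕ) (β : ℝ), 2 ≤ β →
    (∃ c : ℝ, ∀ n : ℕ, 1 ≤ n → ∃ E : EqSystem n, E.Correct ∧
      (∃ g : MvPolynomial (GraphVars n) ℂ, g ∉ MvPolynomial.vanishingIdeal ℂ (mmGraph n) ∧
        Ideal.span {g} * MvPolynomial.vanishingIdeal ℂ (mmGraph n) ^ M ≤
          Ideal.span {p | ∃ j ∈ E.tests, p = E.testPoly j}) ∧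
      (E.cost : ℝ) ≤ c * (n : ℝ) ^ β) →
    ∀ β' : ℝ, β < β' →
      ∃ c : ℝ, ∀ n : ℕ, 1 ≤ n → ∃ E : EqSystem n, E.Correct ∧
        (∃ g : MvPolynomial (GraphVars n) ℂ, g ∉ MvPolynomial.vanishingIdeal ℂ (mmGraph n) ∧
          Ideal.span {g} * MvPolynomial.vanishingIdeal ℂ (mmGraph n) ≤
            Ideal.span {p | ∃ j ∈ E.tests, p = E.testPoly j}) ∧
        (E.cost : ℝ) ≤ c * (n : ℝ) ^ β' := by
  intro M β hβ h β' hββ'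
  obtain ⟨c, hc⟩ := exponentDescent_red M hβ h
  refine ⟨max c 0, fun n hn => ?_⟩
  obtain ⟨E, hE, hg, hcost⟩ := hc n hn
  refine ⟨E, hE, hg, hcost.trans ?_⟩
  have hn1 : (1 : ℝ) ≤ n := by exact_mod_cast hn
  have h1 : (n : ℝ) ^ β ≤ (n : ℝ) ^ β' := Real.rpow_le_rpow_of_exponent_le hn1 hββ'.le
  have h0 : 0 ≤ (n : ℝ) ^ β := Real.rpow_nonneg (by positivity) _
  calc c * (n : ℝ) ^ β ≤ max c 0 * (n : ℝ) ^ β := mul_le_mul_of_nonneg_right (le_max_left c 0) h0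
    _ ≤ max c 0 * (n : ℝ) ^ β' := mul_le_mul_of_nonneg_left h1 (le_max_right c 0)

/-! ## S6(b): the registered line with its middle stub discharged

With `exponentDescent` (= `stub_exponentDescent` of `Cruxes/MultiplicityReduction/Lines/birth.lean`,
by statement) and the rung `exponentOneReduced_holds` (= `expOneReduced`), the composition
`MultiplicityReduction_of` of that skeleton now rests on its FIRST stub alone: the route crux
`MultiplicityReduction` (item 27806) follows from the exponent bound `stub_exponentBound`, whose
statement is the hypothesis `hEB` below, verbatim. -/

/-- **COROLLARY ED-1 (`hM ⟸ ExponentBound` alone).**  If admissible exponents are attained, up to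
every `ε > 0`, by correct families of BOUNDED Loewy exponent (`g · 𝕀(W_n)^M ⊆ (tests)`, `g ∉ 𝕀(W_n)`,
`M` uniform in `n`), then `MultiplicityReduction` holds. -/
theorem multiplicityReduction_of_exponentBound
    (hEB : ∀ β : ℝ, 2 ≤ β → EqAdmissible β → ∀ β' : ℝ, β < β' →
      ∃ M : ℕ, ∃ c : ℝ, ∀ n : ℕ, 1 ≤ n → ∃ E : EqSystem n, E.Correct ∧
        (∃ g : MvPolynomial (GraphVars n) ℂ, g ∉ MvPolynomial.vanishingIdeal ℂ (mmGraph n) ∧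
          Ideal.span {g} * MvPolynomial.vanishingIdeal ℂ (mmGraph n) ^ M ≤
            Ideal.span {p | ∃ j ∈ E.tests, p = E.testPoly j}) ∧
        (E.cost : ℝ) ≤ c * (n : ℝ) ^ β') :
    Summit.MatrixMultiplication.MatrixMultiplication.Theses.GraphEquations.MultiplicityReduction := by
  intro β hβ hadm β' hlt
  obtain ⟨M, hM⟩ := hEB β hβ hadm ((β + β') / 2) (by linarith)
  exact exponentOneReduced_holds β'
    (exponentDescent M ((β + β') / 2) (by linarith) hM β' (by linarith))

end Summit.MatrixMultiplication.MatrixMultiplication.Theorems.GraphEquations
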